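import Literature.NumberTheory.Rogawski1990.LocalStableClassesNonsplitKappa                    -- ★ p840169 `finKappaAt_conj_eq_mul_ite`
import Literature.NumberTheory.Rogawski1990.UnitFundamentalLemmaInertFlickerTorus             -- ★ `twistGram_formCongr`
import Literature.NumberTheory.Rogawski1990.UnitFundamentalLemmaInertFlickerRepresentatives   -- ★ `adelicForm_antidiagOne_map_adeleToLocal`
import Literature.NumberTheory.Rogawski1990.UnitStableOrbitalIntegralIrredOneClass            -- ★ Φ₂ localised = literal
import HarnessLib

/-!
# (J2a)(ii) THE SIGN: `κ_v(γ_H, ·)` FLIPS between the dock images `y ι(h) y⁻¹` and `y ι(x h x⁻¹) y⁻¹` when `γ_H`'s `U(1)`-coordinate sits IN THE PLANE of `h`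
# (Rogawski 1990 §4.3 (4.3.2), §4.9 Prop. 4.9.1, §8.2 Prop. 8.2.1 (c); Labesse–Langlands 1979 §2)

Topic `NumberTheory/Rogawski1990`; namespace `Literature.NumberTheory.Rogawski1990`.  **Theorems only** (no `def`, no instance, no notation, no named fact, no
`sorry`); imports = tree.  Brick (J2a)(ii) of the floor-2 line «N6nsGerm», stub `stub_N6nsS2` (LEAD F0P3a-plan T8-122 ∕ T8-124; dock of record per B-p08 (q8) 07:10:48Z:
the CENTRAL dock ★ `exists_centralDock_of_fst_eq_smul_one`, `(θ z).1.val = y ι(z) y⁻¹`, composed with the torus transport `τ` of ★ `exists_torusTransport`, which moves the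
`U(1)`-coordinate `u(↑t)` of the ORIGINAL torus point INTO THE PLANE of `(τ t).1`).  Companion of ★ `LocalStableClassesHTwo` ((J2a)(i): the two `H_v`-classes).

THE MATHEMATICS.  `κ_v(γ_H, ·)` on the `G′_v`-classes matched with `γ_H` changes under a stable conjugator `g` iff the norm test FAILS on the eigenline of the conjugated
element for the eigenvalue `u = finGammaTwo γ_H` (★ `finKappaAt_conj_eq_iff_normTest` ∕ `finKappaAt_conj_eq_mul_ite`).  Along a dock `z ↦ y ι(z) y⁻¹` whose `y` carries
`U(H′)`'s form to `Φ₃` (`σ(y)ᵀ H′_v y = Φ₃`), the two `H_v`-classes of (J2a)(i) differ by `x ∈ GL₂(E_v)` acting on the PLANE, so the dock images differ by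
`g = y ι(x,1) y⁻¹`, and the `H′`-twisted Gram entries of `g · (y ι(P,1))` at a plane slot ARE the `Φ₂`-twisted Gram entries of `x P` (`twistGram_formCongr` + the `ι`-pattern:
`twistGram_antidiag_endoGL_zero_zero ∕ _two_two`).  Hence: if `u(γ_H)` sits at a PLANE slot (`u = d_j`) and `x` fails the `Φ₂`-test at column `j`, `κ` FLIPS
(`finKappaAt_dock_conj_eq_neg`); if `u(γ_H)` sits on the middle `ι`-line, NO plane conjugator changes `κ` (the census' §3 caveat — not stated here).

* `twistGram_antidiag_endoGL_zero_zero`, `twistGram_antidiag_endoGL_two_two` — `ι`-pattern Gram entries.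
* **`finKappaAt_dock_conj_eq_neg`** — the flip.

## References
* J. Rogawski, *Automorphic Representations of Unitary Groups in Three Variables* (1990), §4.3 (4.3.2) p. 43, §4.8 p. 53, §4.9 Prop. 4.9.1 p. 55, §8.2 Prop. 8.2.1 (c)
  pp. 113–115 [Rogawski1990].
* J.-P. Labesse, R. P. Langlands, *L-indistinguishability for SL(2)*, Canad. J. Math. 31 (1979), §2 [LabesseLanglands1979].
-/

set_option autoImplicit false

noncomputable section

open NumberField IsDedekindDomain Matrix
open scoped MatrixGroups

namespace Literature.NumberTheory.Rogawski1990

open Literature.NumberTheory.Automorphic Literature.NumberTheory.Automorphic.UnitaryGroup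
open Literature.NumberTheory.GaloisRepresentations

section Pattern

variable {R : Type*} [CommRing R] (σ : R →+* R)

/-- The twisted Gram entry of an `ι`-pattern frame `ι(N, 1)` at the plane slot `0` (resp. `2`) w.r.t. `Φ₃` is the twisted Gram entry of `N` at slot `0` (resp. `1`)
w.r.t. `Φ₂`. [cite: Rogawski1990, §4.8 Case (a) p. 53; §3.5 p. 29] -/
theorem twistGram_antidiag_endoGL_zero_zero (N : GL (Fin 2) R) :
    twistGram σ (Matrix.of fun i j : Fin 3 => if i.val + j.val + 1 = 3 then (1 : R) else 0) (endoGL (N, (1 : GL (Fin 1) R))).val 0 0 =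
      twistGram σ (Matrix.of fun i j : Fin 2 => if i.val + j.val + 1 = 2 then (1 : R) else 0) N.val 0 0 := by
  simp [twistGram_def, Matrix.mul_apply, Fin.sum_univ_three, Fin.sum_univ_two, Matrix.of_apply]

/-- As `twistGram_antidiag_endoGL_zero_zero`, at the plane slot `2` ↔ `1`. [cite: Rogawski1990, §4.8 Case (a) p. 53; §3.5 p. 29] -/
theorem twistGram_antidiag_endoGL_two_two (N : GL (Fin 2) R) :
    twistGram σ (Matrix.of fun i j : Fin 3 => if i.val + j.val + 1 = 3 then (1 : R) else 0) (endoGL (N, (1 : GL (Fin 1) R))).val 2 2 =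
      twistGram σ (Matrix.of fun i j : Fin 2 => if i.val + j.val + 1 = 2 then (1 : R) else 0) N.val 1 1 := by
  simp [twistGram_def, Matrix.mul_apply, Fin.sum_univ_three, Fin.sum_univ_two, Matrix.of_apply]

end Pattern

section Flip

variable (L : Type) [Field L] [NumberField L] [IsCMField L] (v : HeightOneSpectrum (𝓞 ↥(maximalRealSubfield L)))
  (H' : Matrix (Fin 3) (Fin 3) L)

/-- **(J2a)(ii) THE κ-FLIP ALONG A DOCK `z ↦ y ι(z) y⁻¹`.**  At a non-split `v`, let `γ_H ∈ H_v` (the FIRST slot of `Δ‴_v`, `u := finGammaTwo γ_H`, `G`-regular: `hu`),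
`b ∈ G′_v` matched with `γ_H`, with eigenframe `y ι(P, 1)` and eigenvalues `(d₀, u₁, d₁)` (plane slots `0, 2` ↔ `P`'s columns `0, 1`; middle slot = the `ι`-line), where the
conjugator `y` carries `U(H′)`'s form to `Φ₃` (`σ(y)ᵀ H′ y = Φ₃`, the dock's form relation) — and suppose `γ_H`'s `U(1)`-coordinate `u` sits IN THE PLANE: `u = dⱼ`, `j ∈ {0,1}`.
If `x ∈ GL₂(E_v)` FAILS the `Φ₂`-norm test at `P`'s column `j`, then for `b′ = g b g⁻¹`, `g = y ι(x,1) y⁻¹`: **`κ_v(γ_H, b′) = −κ_v(γ_H, b)`** — ★ `finKappaAt_conj_eq_mul_ite` at the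
slot of `u`, the test of `g` there being the `Φ₂`-test of `x` at column `j` (`σ(y)ᵀH′y = Φ₃` + the `ι`-pattern Gram entries).  This is the sign half of the junction binder (J2a)
`halt` for the central dock `θ z = y ι(z) y⁻¹` (★ `exists_centralDock_of_fst_eq_smul_one`) composed with the torus transport `τ` that moves `u(γ_H)` into the plane.
[cite: Rogawski1990, §4.3 (4.3.2) p. 43; §4.9 Prop. 4.9.1 p. 55; §8.2 Prop. 8.2.1 (c) pp. 113–115] [cite: LabesseLanglands1979, §2] -/
theorem finKappaAt_dock_conj_eq_neg (w : PlacesOver L v) (hw : IsCMField.complexConj L • w.1 = w.1)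
    {a : (cmDatum L 2 (Matrix.of fun i j : Fin 2 => if i.val + j.val + 1 = 2 then (1 : L) else 0)).Local v ×
      (cmDatum L 1 (Matrix.of fun i j : Fin 1 => if i.val + j.val + 1 = 1 then (1 : L) else 0)).Local v}
    {b b' : (cmDatum L 3 H').Local v} (h : IsLocalNormPair L H' v a b)
    (hu : IsUnit ((finCharpolyTwo L v a).eval (finGammaTwo L v a)))
    (hH : (((adelicForm L 3 H').map (adeleToLocal L v)).map (conjLocal L (IsCMField.complexConj L) v))ᵀ = (adelicForm L 3 H').map (adeleToLocal L v))
    (hHd : IsUnit ((adelicForm L 3 H').map (adeleToLocal L v)).det)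
    {y : GL (Fin 3) (LocalRing L v)}
    (hy : formCongr (conjLocal L (IsCMField.complexConj L) v) y ((adelicForm L 3 H').map (adeleToLocal L v)) =
      Matrix.of fun i j : Fin 3 => if i.val + j.val + 1 = 3 then (1 : LocalRing L v) else 0)
    {P x : GL (Fin 2) (LocalRing L v)} {d₀ d₁ u₁ : LocalRing L v}
    (hP : (b.val.val : Matrix (Fin 3) (Fin 3) (LocalRing L v)) * (y * endoGL (P, (1 : GL (Fin 1) (LocalRing L v)))).val =
      (y * endoGL (P, (1 : GL (Fin 1) (LocalRing L v)))).val * diagonal ![d₀, u₁, d₁])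
    (hinj : Function.Injective ![d₀, u₁, d₁]) (h1 : ∀ i, conjLocal L (IsCMField.complexConj L) v (![d₀, u₁, d₁] i) * ![d₀, u₁, d₁] i = 1)
    {j : Fin 2} (hj : ![d₀, d₁] j = finGammaTwo L v a)
    (hfail : ¬ ∃ z : LocalRing L v, IsUnit z ∧
      twistGram (conjLocal L (IsCMField.complexConj L) v) (Matrix.of fun i j : Fin 2 => if i.val + j.val + 1 = 2 then (1 : LocalRing L v) else 0)
          (x.val * P.val) j j =
        conjLocal L (IsCMField.complexConj L) v z * z *
          twistGram (conjLocal L (IsCMField.complexConj L) v) (Matrix.of fun i j : Fin 2 => if i.val + j.val + 1 = 2 then (1 : LocalRing L v) else 0) P.val j j)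
    (hg : (y * endoGL (x, (1 : GL (Fin 1) (LocalRing L v))) * y⁻¹) * b.val * (y * endoGL (x, (1 : GL (Fin 1) (LocalRing L v))) * y⁻¹)⁻¹ = b'.val) :
    finKappaAt L v H' a b' = - finKappaAt L v H' a b := by
  -- the frame product `g · (y ι(P,1)) = y ι(xP, 1)`
  have hgP : (y * endoGL (x, (1 : GL (Fin 1) (LocalRing L v))) * y⁻¹).val * (y * endoGL (P, (1 : GL (Fin 1) (LocalRing L v)))).val =
      y.val * (endoGL (x * P, (1 : GL (Fin 1) (LocalRing L v)))).val := by
    rw [← Units.val_mul, show (y * endoGL (x, (1 : GL (Fin 1) (LocalRing L v))) * y⁻¹) * (y * endoGL (P, (1 : GL (Fin 1) (LocalRing L v)))) =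
        y * endoGL (x * P, (1 : GL (Fin 1) (LocalRing L v))) by
      rw [show ((x * P, (1 : GL (Fin 1) (LocalRing L v))) : GL (Fin 2) (LocalRing L v) × GL (Fin 1) (LocalRing L v)) = (x, 1) * (P, 1) by
        rw [Prod.mk_mul_mk, mul_one], map_mul]; group]
    rfl
  have hyP : (y * endoGL (P, (1 : GL (Fin 1) (LocalRing L v)))).val = y.val * (endoGL (P, (1 : GL (Fin 1) (LocalRing L v)))).val := rfl
  -- the slot of `u = finGammaTwo a` in the frame `(d₀, u₁, d₁)`
  fin_cases j
  · have hj0 : ![d₀, u₁, d₁] 0 = finGammaTwo L v a := by simpa using hj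
    rw [finKappaAt_conj_eq_mul_ite L v H' a b b' w hw h hu hH hHd hP hinj h1 hj0 hg, if_neg, mul_neg_one]
    rw [hgP, hyP, twistGram_formCongr, twistGram_formCongr, hy, twistGram_antidiag_endoGL_zero_zero, twistGram_antidiag_endoGL_zero_zero]
    simpa using hfail
  · have hj2 : ![d₀, u₁, d₁] 2 = finGammaTwo L v a := by simpa using hj
    rw [finKappaAt_conj_eq_mul_ite L v H' a b b' w hw h hu hH hHd hP hinj h1 hj2 hg, if_neg, mul_neg_one]
    rw [hgP, hyP, twistGram_formCongr, twistGram_formCongr, hy, twistGram_antidiag_endoGL_two_two, twistGram_antidiag_endoGL_two_two]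
    simpa using hfail

end Flip

end Literature.NumberTheory.Rogawski1990
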